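import Literature.NumberTheory.EllipticCurves.TianYuanZhang2017.CongruentRealPeriodProofs
import Literature.NumberTheory.QuadraticFields.RedeiMatrixFourRank
import Literature.NumberTheory.EllipticCurves.CongruentNumberCurveRootNumberEven
import Literature.NumberTheory.EllipticCurves.CongruentNumberCurveLSeriesProofs
import Literature.NumberTheory.EllipticCurves.GrossZagierRationalPoint
import Literature.NumberTheory.EllipticCurves.RegulatorProofs
import HarnessLib

/-!
# Tian–Yuan–Zhang Thm 1.2 at `ρ(n) = 0`: odd genus sums force `𝓛(n)` odd, `r_an(E_n) = 1` and `L′(E_n,1) = 2^{2k−2−a}·𝓛(n)²·Ω(E_n)·Reg(E_n)`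

**ERRATUM F-Σ2 (2026-08-22).** The displayed fact `thm12_parity_of_scriptL` used in §3–§5 is
MIS-STATED in its `Σ₂` clauses (see `GenusPeriodsParity.lean`); §6 re-derives every consequence from the
corrected fact `thm12_parity_of_scriptL'` with the corrected sum `genusSum₂'` (primed names).  Consumers
should migrate to the primed theorems; the `Σ₁`-branch conclusions are identical.

HONEST FRAMING (cell `b2b-bsdres`, sub-lane «bsd-p2», run/shared/lean/b2b/bsd-rank1-residual/p2/;
seat p2-lit-1 GEN 5; door candidate D-CN-6 of `p2/LIT-STATUS.md` rows T1-M15…M17, lead rulings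
L1-17 / L1-21 / ME-29): PROOFS ONLY — no definition, no named fact. Everything here is a
CONSEQUENCE of the typed (unproved, displayed-as-hypothesis) journal fact
`TianYuanZhang2017.thm12_parity_of_scriptL` (Tian–Yuan–Zhang 2017 Thm 1.2) under the ADDED
per-`n` hypothesis `ρ(n) = 0`, rendered `(rhoSubgroup n).index = 1` (`2^{ρ(n)} = [E_n(ℚ) :
φ_n(A_n(ℚ)) + E_n[2]]`, [cite: TianYuanZhang2017, §1 (arXiv:1411.4728 chunk p0002 L101–L110)]).

READING OF RECORD (row T1-M17 (A)). Thm 1.2 [cite: TianYuanZhang2017, Thm. 1.2 (chunk p0002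
L112–L127)]: "Let `n ≡ 5, 6, 7 (mod 8)` be a positive and square-free integer. Then `𝓛(n)` is an
integer. If `n ≡ 5, 7 (mod 8)`, then `2^{−ρ(n)}𝓛(n)` is even only if `Σ₁ ≡ Σ₂ ≡ 0 (mod 2)`. If
`n ≡ 6 (mod 8)`, then `2^{−ρ(n)}𝓛(n)` is even only if `Σ₂ ≡ 0 (mod 2)`" — with, by the authors'
§3 (Thm 3.5, chunk p0011 L97–L100: "Assume that `P(n) ∈ A(K_n)⁻ + A[4]`, i.e. `2^{−ρ(n)}𝓛(n)` is
even"), "`2^{−ρ(n)}𝓛(n)` even" MEANING `2^{ρ(n)+1} ∣ 𝓛(n)` (the typed form). `ρ(n)` is thus a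
PARAMETER of the divisibility clause, neither a hypothesis nor a conclusion; a consumer may ADD
`ρ(n) = 0` as its own hypothesis, whereupon the printed theorem yields `2 ∤ 𝓛(n)`:
* `exists_odd_scriptL_of_index_eq_one` (classes 5, 7: `Σ₁` odd or `Σ₂` odd) and
  `exists_odd_scriptL_of_index_eq_one_six` (class 6: `Σ₂` odd): `∃ L odd, L² = 𝓛(n)²`;
* `analyticRank_congruentNumberCurve_eq_one_of_isScriptL` : an odd (indeed any non-zero) `𝓛(n)`
  forces `ord_{s=1} L(E_n, s) = 1` — `𝓛(n)² ≠ 0` excludes order `≥ 2` by the DEFINITION of `𝓛`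
  (p0002 L46–L75: "`0` if `ord > 1`"), and order `0` is excluded by the sign: `L(E_n, 1) = 0` for
  square-free `n ≡ 5, 6, 7 (mod 8)` (tree THEOREM `entireLFunction_congruentNumberCurve_one_eq_zero_of_mod_eight`);
* `leadingLCoeff_congruentNumberCurve_eq_of_isScriptL` : then
  `L′(E_n, 1) = 2^{2k(n)−2−a(n)} · 𝓛(n)² · Ω(E_n) · Reg(E_n)` with the TREE's period and regulator
  (`Ω(E_n) = Ω_{n,∞}` is the theorem `realPeriodRat_congruentNumberCurve`, p321577; `R_n = Reg`
  by definition) — i.e. the rank-one datum `x = L′/(Ω·Reg) = 2^{2k−2−a}·𝓛(n)²` of door D-CN-5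
  (`P2/CongruentNumberPairsAtTwoRankOne.lean`) WITHOUT any L-value computation, with
  `ord₂ x = 2k(n) − 2 − a(n)` exactly when `𝓛(n)` is odd (`rankOneDatum_of_index_eq_one`).
* The genus-sum hypothesis is decidable per `n` from Rédei matrices: `g(d) = #2Cl(ℚ(√−d))` is ODD
  iff `Cl(ℚ(√−d))` has no element of order 4 iff `#(2Cl ∩ Cl[2]) = 1` — the group lemma
  `odd_card_isSquare_iff_fourTwoCard_eq_one` (Cauchy) — and `#(2Cl ∩ Cl[2]) = 2^{t−1−rank R}`
  is the displayed Rédei–Reichardt fact `redeiReichardt_fourTwoCard_classGroup` (p319707):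
  `odd_genusClassNumber_iff_of_redeiReichardt`; the sums `Σ₁, Σ₂` depend on `g` only through
  `g mod 2` (`genusSum₁_mod_two`, `genusSum₂_mod_two`).
What is NOT here (row T1-M17 (C)): the certificate `ŝ(n) = 0 ⇒ ρ(n) = 0` (RHO-CERT-NOTE §E, the
descent injection for `isogenyImageTYZ` — not in tree currency), `Ш(E_n)[2] = 0` from `s(n) = 1`,
`#E_n(ℚ)_tors = 4`, and the Tamagawa valuation `ord₂ ∏ c_ℓ(E_n) = 2k(n) + 2 − a(n)` (GAP G-T1);
the door composing them lives in `Summits/…/Rank1Residual/P2/` (one writer: p2-typer).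

ADDENDUM (p2-lit-1 GEN 6, lead ask L1-40, row T1-M28): §5 runs the same chain at a GENERAL
`ρ(n)` (`(rhoSubgroup n).index = 2 ^ ρ`, the binder of the typed fact): odd genus sums give
`2^{ρ+1} ∤ 𝓛(n)` (so `𝓛(n) ≠ 0`, `ord₂ 𝓛(n) ≤ ρ`), hence STILL `ord_{s=1} L(E_n, s) = 1` and
`L′(E_n, 1) = 2^{2k−2−a}·𝓛(n)²·Ω(E_n)·Reg(E_n)` (`rankOneDatum_of_index_eq_two_pow`, `…_six`). What
print does NOT give at `ρ ≥ 1` is the exact parity of `𝓛(n)`: a `ρ = 1` consumer gets a RANK-ONE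
datum (and `ord₂ 𝓛(n)² ≤ 2ρ`), not a `2`-part statement.

## References
* [TianYuanZhang2017] Y. Tian, X. Yuan, S.-W. Zhang, *Genus periods, genus points and congruent
  number problem*, Asian J. Math. 21 (2017) 721–774, Thm 1.2, §1 (ρ(n), 𝓛(n), Ω_{n,∞}), Thm 3.5.
* [Tian2023CongruentICM] Y. Tian, ICM 2022, Thm 13 (= TYZ Thm 1.2; its "odd" phrasing is the
  contrapositive reading above — row T1-M16′: the literal phrasing fails numerically).
* Tree: `GenusPeriodsParity.lean` (the typed facts), `CongruentRealPeriodProofs.lean` (Ω),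
  `QuadraticFields/RedeiMatrixFourRank.lean` (Rédei–Reichardt), `CongruentNumberCurveRootNumberEven.lean`
  (`L(E_n,1) = 0`), `GrossZagierRationalPoint.lean` (`leadingLCoeff = L′` in analytic rank one).
-/

noncomputable section

open scoped Classical

open NumberField WeierstrassCurve Finset

namespace Literature.NumberTheory.EllipticCurves.TianYuanZhang2017

open Literature.NumberTheory.EllipticCurves Literature.NumberTheory.EllipticCurves.Tian2014
  Literature.NumberTheory.QuadraticFields.RedeiReichardt

/-! ### §1. `g(d)` odd ⟺ no ideal class of order 4: a lemma on finite abelian groups -/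

/-- In a finite commutative group, the order is odd iff `1` is the only element killed by `2`
(Lagrange one way, Cauchy the other). [folklore] -/
private theorem odd_natCard_iff_forall_sq_eq_one (G : Type*) [CommGroup G] [Finite G] :
    Odd (Nat.card G) ↔ ∀ g : G, g ^ 2 = 1 → g = 1 := by
  constructor
  · intro hodd g hg
    have h2 : orderOf g ∣ 2 := orderOf_dvd_of_pow_eq_one hg
    have hG : Odd (orderOf g) := hodd.of_dvd_nat (orderOf_dvd_natCard g)
    rcases (Nat.dvd_prime Nat.prime_two).mp h2 with h | h
    · exact orderOf_eq_one_iff.mp h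
    · exact absurd hG (by rw [h]; decide)
  · intro h
    by_contra hne
    have heven : 2 ∣ Nat.card G := even_iff_two_dvd.mp (Nat.not_odd_iff_even.mp hne)
    obtain ⟨x, hx⟩ := exists_prime_orderOf_dvd_card' 2 heven
    have hx1 : x = 1 := h x (by rw [← hx]; exact pow_orderOf_eq_one x)
    rw [hx1, orderOf_one] at hx
    exact absurd hx (by decide)

/-- **`#2𝒜` is odd iff `#(2𝒜 ∩ 𝒜[2]) = 1`** for a finite commutative group `𝒜` (iff `𝒜` has no
element of order `4`, Tian's `dim_{𝔽₂} 𝒜[4]/𝒜[2] = 0`): the parity of the genus class number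
`g = #2Cl` is the vanishing of the `4`-rank. The squares form the subgroup `2𝒜 = range (x ↦ x²)`
(Mathlib's `powMonoidHom 2`), to which the previous lemma applies.
[cite: Tian2014, proof of Lemma 5.1 (arXiv p. 28, L13–L16: 𝒜[4]/𝒜[2] ≅ 𝒜[2] ∩ 2𝒜)] -/
theorem odd_card_isSquare_iff_fourTwoCard_eq_one (A : Type*) [CommGroup A] [Finite A] :
    Odd (Nat.card {a : A // IsSquare a}) ↔ fourTwoCard A = 1 := by
  have hmem : ∀ a : A, a ∈ (powMonoidHom 2 : A →* A).range ↔ IsSquare a := fun a => by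
    rw [MonoidHom.mem_range, isSquare_iff_exists_sq]
    exact ⟨fun ⟨x, hx⟩ => ⟨x, hx.symm⟩, fun ⟨x, hx⟩ => ⟨x, hx.symm⟩⟩
  have hS : Nat.card {a : A // IsSquare a} = Nat.card (powMonoidHom 2 : A →* A).range :=
    Nat.card_congr (Equiv.subtypeEquivRight fun a => (hmem a).symm)
  rw [hS, odd_natCard_iff_forall_sq_eq_one, fourTwoCard_def]
  constructor
  · intro h
    rw [Nat.card_eq_one_iff_exists]
    refine ⟨⟨1, IsSquare.one, one_pow 2⟩, ?_⟩
    rintro ⟨a, hsq, ha⟩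
    have := h ⟨a, (hmem a).mpr hsq⟩ (Subtype.ext (by simpa using ha))
    exact Subtype.ext (by simpa using congrArg Subtype.val this)
  · intro h g hg
    obtain ⟨z, hz⟩ := Nat.card_eq_one_iff_exists.mp h
    have h1 := hz ⟨1, IsSquare.one, one_pow 2⟩
    have hgA : (g : A) ^ 2 = 1 := by
      have := congrArg Subtype.val hg
      simpa using this
    have h2 := hz ⟨(g : A), (hmem g).mp g.2, hgA⟩
    have : ((g : A)) = 1 := by
      have := congrArg Subtype.val (h2.trans h1.symm)
      simpa using this
    exact Subtype.ext this

/-- `g(K) = #2Cl(K)` is odd iff `#(2Cl(K) ∩ Cl(K)[2]) = 1` (no ideal class of order `4`).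
[cite: Tian2014, proof of Lemma 5.1 (arXiv p. 28, L13–L16)] [cite: TianYuanZhang2017, §1 (p0002 L78–L82: g(d) = #2Cl(ℚ(√−d)))] -/
theorem odd_genusClassNumber_iff (K : Type*) [Field K] [NumberField K] :
    Odd (genusClassNumber K) ↔ fourTwoCard (ClassGroup (𝓞 K)) = 1 :=
  odd_card_isSquare_iff_fourTwoCard_eq_one _

/-- **Per-`d` decision of `g(d) mod 2` by a Rédei matrix** (under the displayed Rédei–Reichardt fact
`#(2Cl ∩ Cl[2]) = 2^{t − 1 − rank R(−d)}`): for `K = ℚ(√−d)` and a prime tuple `p` of the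
discriminant, `g(d)` is odd iff `t − 1 − rank (redeiMatrix d p) = 0`.
[cite: LiMa2008, Lemma 0.1 (Rédei–Reichardt)] [cite: TianYuanZhang2017, Cor. 1.4 (the hypothesis "no ideal class of exact order 4")] -/
theorem odd_genusClassNumber_iff_of_redeiReichardt (hR : redeiReichardt_fourTwoCard_classGroup)
    {d t : ℕ} {p : Fin t → ℕ} (hp : ∀ i, (p i).Prime) (hinj : Function.Injective p)
    (hprod : ∏ i, p i = if d % 4 = 1 then 2 * d else d)
    (K : Type) [Field K] [NumberField K] (hK : IsQuadraticFieldOfSqrt K (-(d : ℤ))) :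
    Odd (genusClassNumber K) ↔ t - 1 - (redeiMatrix d p).rank = 0 := by
  rw [odd_genusClassNumber_iff, hR d t p hp hinj hprod K hK]
  constructor
  · intro h
    by_contra hne
    have : 2 ≤ 2 ^ (t - 1 - (redeiMatrix d p).rank) :=
      le_self_pow₀ (by norm_num) hne
    omega
  · intro h
    rw [h, pow_zero]

/-! ### §2. The genus sums depend on `g` only modulo `2` -/

/-- `Σ₁(n; g) ≡ Σ₁(n; g mod 2) (mod 2)`: the parity of the first genus sum is decided by the
parities `g(d) mod 2`, `d ∣ n`. [cite: TianYuanZhang2017, Thm. 1.2 (Σ₁)] -/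
theorem genusSum₁_mod_two (n : ℕ) (g : ℕ → ℕ) :
    genusSum₁ n g % 2 = genusSum₁ n (fun d => g d % 2) % 2 := by
  unfold genusSum₁
  rw [Finset.sum_nat_mod, Finset.sum_congr rfl fun D _ => Finset.prod_nat_mod D 2 g]
  conv_rhs => rw [Finset.sum_nat_mod, Finset.sum_congr rfl fun D _ => Finset.prod_nat_mod D 2 _]
  simp only [Nat.mod_mod]

/-- `Σ₂(n; g) ≡ Σ₂(n; g mod 2) (mod 2)`. [cite: TianYuanZhang2017, Thm. 1.2 (Σ₂)] -/
theorem genusSum₂_mod_two (n : ℕ) (g : ℕ → ℕ) :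
    genusSum₂ n g % 2 = genusSum₂ n (fun d => g d % 2) % 2 := by
  unfold genusSum₂
  rw [Finset.sum_nat_mod, Finset.sum_congr rfl fun D _ => Finset.prod_nat_mod D 2 g]
  conv_rhs => rw [Finset.sum_nat_mod, Finset.sum_congr rfl fun D _ => Finset.prod_nat_mod D 2 _]
  simp only [Nat.mod_mod]

/-- Parity transfer: `Σ₁(n; g)` is odd iff `Σ₁(n; g′)` is, whenever `g ≡ g′ (mod 2)` on the divisors
`d > 1` of `n` (all factors of a decomposition are divisors `> 1` of `n`). [cite: TianYuanZhang2017, Thm. 1.2 (Σ₁)] -/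
theorem odd_genusSum₁_iff_of_mod_two_eq (n : ℕ) {g g' : ℕ → ℕ}
    (h : ∀ d ∈ n.divisors, 1 < d → g d % 2 = g' d % 2) :
    Odd (genusSum₁ n g) ↔ Odd (genusSum₁ n g') := by
  have key : genusSum₁ n (fun d => g d % 2) = genusSum₁ n (fun d => g' d % 2) := by
    unfold genusSum₁
    refine Finset.sum_congr rfl fun D hD => Finset.prod_congr rfl fun d hd => h d ?_ ?_
    · simp only [Finset.mem_filter, decompositions, Finset.mem_powerset] at hD
      exact hD.1.1 hd
    · simp only [Finset.mem_filter, decompositions, Finset.mem_powerset] at hD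
      exact hD.1.2.1 d hd
  rw [Nat.odd_iff, Nat.odd_iff, genusSum₁_mod_two, key, ← genusSum₁_mod_two]

/-- Parity transfer for `Σ₂`. [cite: TianYuanZhang2017, Thm. 1.2 (Σ₂)] -/
theorem odd_genusSum₂_iff_of_mod_two_eq (n : ℕ) {g g' : ℕ → ℕ}
    (h : ∀ d ∈ n.divisors, 1 < d → g d % 2 = g' d % 2) :
    Odd (genusSum₂ n g) ↔ Odd (genusSum₂ n g') := by
  have key : genusSum₂ n (fun d => g d % 2) = genusSum₂ n (fun d => g' d % 2) := by
    unfold genusSum₂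
    refine Finset.sum_congr rfl fun D hD => Finset.prod_congr rfl fun d hd => h d ?_ ?_
    · simp only [Finset.mem_filter, decompositions, Finset.mem_powerset] at hD
      exact hD.1.1 hd
    · simp only [Finset.mem_filter, decompositions, Finset.mem_powerset] at hD
      exact hD.1.2.1 d hd
  rw [Nat.odd_iff, Nat.odd_iff, genusSum₂_mod_two, key, ← genusSum₂_mod_two]

/-! ### §3. Thm 1.2 at `ρ(n) = 0`: odd genus sums force `𝓛(n)` odd -/

/-- **TYZ Thm 1.2 with the added hypothesis `ρ(n) = 0`, classes `5` and `7`:** if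
`[E_n(ℚ) : φ_n(A_n(ℚ)) + E_n[2]] = 1` and `Σ₁` or `Σ₂` is odd, then `𝓛(n)` is an ODD integer
(`L² = 𝓛(n)²` with `L` odd). Immediate from the printed "2^{−ρ}𝓛 even only if Σ₁ ≡ Σ₂ ≡ 0" at `ρ = 0`.
[cite: TianYuanZhang2017, Thm. 1.2 (chunk p0002 L112–L120)] -/
theorem exists_odd_scriptL_of_index_eq_one (h12 : thm12_parity_of_scriptL) {n : ℕ}
    (hsq : Squarefree n) (h8 : n % 8 = 5 ∨ n % 8 = 7) (hρ : (rhoSubgroup n).index = 1)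
    (K : ℕ → Type) [∀ d, Field (K d)] [∀ d, NumberField (K d)] (hK : IsGenusFieldFamily n K)
    (hodd : Odd (genusSum₁ n fun d => genusClassNumber (K d)) ∨
      Odd (genusSum₂ n fun d => genusClassNumber (K d))) :
    ∃ L : ℤ, Odd L ∧ IsScriptL n L := by
  obtain ⟨L, hL, h57, -⟩ := h12 n hsq (by omega) 0 (by simpa using hρ) K hK
  refine ⟨L, ?_, hL⟩
  by_contra hne
  have h2 : (2 : ℤ) ^ (0 + 1) ∣ L := by simpa using (Int.not_odd_iff_even.mp hne).two_dvd
  obtain ⟨e₁, e₂⟩ := h57 h8 h2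
  rcases hodd with ho | ho
  · exact (Nat.not_even_iff_odd.mpr ho) e₁
  · exact (Nat.not_even_iff_odd.mpr ho) e₂

/-- **TYZ Thm 1.2 with `ρ(n) = 0`, class `6`:** `Σ₂` odd forces `𝓛(n)` odd.
[cite: TianYuanZhang2017, Thm. 1.2 (chunk p0002 L121–L127)] -/
theorem exists_odd_scriptL_of_index_eq_one_six (h12 : thm12_parity_of_scriptL) {n : ℕ}
    (hsq : Squarefree n) (h8 : n % 8 = 6) (hρ : (rhoSubgroup n).index = 1)
    (K : ℕ → Type) [∀ d, Field (K d)] [∀ d, NumberField (K d)] (hK : IsGenusFieldFamily n K)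
    (hodd : Odd (genusSum₂ n fun d => genusClassNumber (K d))) :
    ∃ L : ℤ, Odd L ∧ IsScriptL n L := by
  obtain ⟨L, hL, -, h6⟩ := h12 n hsq (by omega) 0 (by simpa using hρ) K hK
  refine ⟨L, ?_, hL⟩
  by_contra hne
  have h2 : (2 : ℤ) ^ (0 + 1) ∣ L := by simpa using (Int.not_odd_iff_even.mp hne).two_dvd
  exact (Nat.not_even_iff_odd.mpr hodd) (h6 h8 h2)

/-! ### §4. Consequences of `𝓛(n) ≠ 0`: analytic rank one and the leading coefficient -/

/-- A non-zero `𝓛(n)` (e.g. an odd one) forces `ord_{s=1} L(E_n, s) = 1` for square-free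
`n ≡ 5, 6, 7 (mod 8)`: order `≥ 2` gives `𝓛(n)² = 0` by definition, order `0` contradicts
`L(E_n, 1) = 0` (root number `−1`). [cite: TianYuanZhang2017, §1 (definition of 𝓛(n), p0002 L46–L75)] -/
theorem analyticRank_congruentNumberCurve_eq_one_of_isScriptL {n : ℕ} (hsq : Squarefree n)
    (h8 : n % 8 = 5 ∨ n % 8 = 6 ∨ n % 8 = 7) {L : ℤ} (hL : IsScriptL n L) (hL0 : L ≠ 0) :
    (congruentNumberCurve n).analyticRank = 1 := by
  haveI := isElliptic_congruentNumberCurve (Squarefree.ne_zero hsq)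
  have hne : (congruentNumberCurve n).analyticRank ≠ 0 :=
    analyticRank_ne_zero_of_entireLFunction_one_eq_zero _
      (hasEntireLFunction_congruentNumberCurve_holds hsq)
      (entireLFunction_congruentNumberCurve_one_eq_zero_of_mod_eight hsq h8)
  by_contra h1
  have hsq0 : scriptLSq n = 0 := by
    unfold scriptLSq
    rw [if_neg hne, if_neg h1]
  have : ((L : ℂ)) ^ 2 = 0 := by rw [hL, hsq0]
  exact hL0 (by exact_mod_cast pow_eq_zero_iff (n := 2) (by norm_num) |>.mp this)

/-- In analytic rank one, `𝓛(n)² = L′(E_n,1)/(2^{2k−2−a} Ω_{n,∞} R_n)` unfolds to the identity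
`L′(E_n, 1) = leadingLCoeff = 2^{2k(n)−2−a(n)} · 𝓛(n)² · Ω(E_n) · Reg(E_n)` with the TREE's period
(`Ω(E_n) = Ω_{n,∞}`, `realPeriodRat_congruentNumberCurve`) and regulator (`R_n = Reg` by definition).
[cite: TianYuanZhang2017, §1 (definition of 𝓛(n) and (1.1), p0002 L46–L75)] -/
theorem leadingLCoeff_congruentNumberCurve_eq_of_isScriptL {n : ℕ} (hn : 0 < n)
    (hr : (congruentNumberCurve n).analyticRank = 1) {L : ℤ} (hL : IsScriptL n L) :
    (congruentNumberCurve n).leadingLCoeff =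
      (2 : ℂ) ^ twoExponent n * (L : ℂ) ^ 2 *
        ((congruentNumberCurve n).realPeriodRat : ℂ) * ((congruentNumberCurve n).regulator : ℂ) := by
  haveI := isElliptic_congruentNumberCurve hn.ne'
  have hΩ : (0 : ℝ) < (congruentNumberCurve n).realPeriodRat :=
    ((congruentNumberCurve n).baseChange ℝ).realPeriod_pos'
  have hR : (0 : ℝ) < (congruentNumberCurve n).regulator := (congruentNumberCurve n).regulator_pos'
  have hΩ' : (realPeriodTYZ n : ℂ) ≠ 0 := by
    rw [← realPeriodRat_congruentNumberCurve hn]; exact_mod_cast hΩ.ne'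
  have hR' : (regulatorTYZ n : ℂ) ≠ 0 := by
    unfold regulatorTYZ; exact_mod_cast hR.ne'
  have h2 : (2 : ℂ) ^ twoExponent n ≠ 0 := zpow_ne_zero _ two_ne_zero
  have key : ((L : ℂ)) ^ 2 = (congruentNumberCurve n).leadingLCoeff /
      ((2 : ℂ) ^ twoExponent n * (realPeriodTYZ n : ℂ) * (regulatorTYZ n : ℂ)) := by
    rw [hL]; unfold scriptLSq; rw [if_neg (by rw [hr]; exact one_ne_zero), if_pos hr]
  rw [eq_div_iff (mul_ne_zero (mul_ne_zero h2 hΩ') hR')] at key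
  rw [← realPeriodRat_congruentNumberCurve hn] at key
  unfold regulatorTYZ at key
  rw [← key]; ring

/-- **The rank-one datum of door D-CN-5 from TYZ Thm 1.2 at `ρ(n) = 0`** (classes `5`, `7`): under the
displayed fact `thm12_parity_of_scriptL`, for square-free `n ≡ 5, 7 (mod 8)` with
`[E_n(ℚ) : φ_n(A_n(ℚ)) + E_n[2]] = 1` and `Σ₁` or `Σ₂` odd, `ord_{s=1} L(E_n, s) = 1` and
`L′(E_n, 1) = 2^{2k(n)−2−a(n)} · L² · Ω(E_n) · Reg(E_n)` with `L` an ODD integer — no L-value is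
computed. [cite: TianYuanZhang2017, Thm. 1.2 and §1 (1.1)] -/
theorem rankOneDatum_of_index_eq_one (h12 : thm12_parity_of_scriptL) {n : ℕ}
    (hsq : Squarefree n) (h8 : n % 8 = 5 ∨ n % 8 = 7) (hρ : (rhoSubgroup n).index = 1)
    (K : ℕ → Type) [∀ d, Field (K d)] [∀ d, NumberField (K d)] (hK : IsGenusFieldFamily n K)
    (hodd : Odd (genusSum₁ n fun d => genusClassNumber (K d)) ∨
      Odd (genusSum₂ n fun d => genusClassNumber (K d))) :
    ∃ L : ℤ, Odd L ∧ (congruentNumberCurve n).analyticRank = 1 ∧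
      deriv (congruentNumberCurve n).entireLFunction 1 =
        (2 : ℂ) ^ twoExponent n * (L : ℂ) ^ 2 *
          ((congruentNumberCurve n).realPeriodRat : ℂ) * ((congruentNumberCurve n).regulator : ℂ) := by
  obtain ⟨L, hLodd, hL⟩ := exists_odd_scriptL_of_index_eq_one h12 hsq h8 hρ K hK hodd
  have hL0 : L ≠ 0 := fun h => by simp [h] at hLodd
  have hr := analyticRank_congruentNumberCurve_eq_one_of_isScriptL hsq (by omega) hL hL0
  refine ⟨L, hLodd, hr, ?_⟩
  rw [← (leadingLCoeff_eq_deriv_of_analyticRank_eq_one hr).1]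
  exact leadingLCoeff_congruentNumberCurve_eq_of_isScriptL (Nat.pos_of_ne_zero hsq.ne_zero) hr hL

/-- Class `6` companion of `rankOneDatum_of_index_eq_one` (`Σ₂` odd). [cite: TianYuanZhang2017, Thm. 1.2 and §1 (1.1)] -/
theorem rankOneDatum_of_index_eq_one_six (h12 : thm12_parity_of_scriptL) {n : ℕ}
    (hsq : Squarefree n) (h8 : n % 8 = 6) (hρ : (rhoSubgroup n).index = 1)
    (K : ℕ → Type) [∀ d, Field (K d)] [∀ d, NumberField (K d)] (hK : IsGenusFieldFamily n K)
    (hodd : Odd (genusSum₂ n fun d => genusClassNumber (K d))) :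
    ∃ L : ℤ, Odd L ∧ (congruentNumberCurve n).analyticRank = 1 ∧
      deriv (congruentNumberCurve n).entireLFunction 1 =
        (2 : ℂ) ^ twoExponent n * (L : ℂ) ^ 2 *
          ((congruentNumberCurve n).realPeriodRat : ℂ) * ((congruentNumberCurve n).regulator : ℂ) := by
  obtain ⟨L, hLodd, hL⟩ := exists_odd_scriptL_of_index_eq_one_six h12 hsq h8 hρ K hK hodd
  have hL0 : L ≠ 0 := fun h => by simp [h] at hLodd
  have hr := analyticRank_congruentNumberCurve_eq_one_of_isScriptL hsq (by omega) hL hL0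
  refine ⟨L, hLodd, hr, ?_⟩
  rw [← (leadingLCoeff_eq_deriv_of_analyticRank_eq_one hr).1]
  exact leadingLCoeff_congruentNumberCurve_eq_of_isScriptL (Nat.pos_of_ne_zero hsq.ne_zero) hr hL

/-! ### §5. Thm 1.2 at a general `ρ(n)`: odd genus sums force `2^{ρ+1} ∤ 𝓛(n)` and analytic rank one -/

/-- **TYZ Thm 1.2 at any `ρ(n)`, classes `5` and `7`:** if `[E_n(ℚ) : φ_n(A_n(ℚ)) + E_n[2]] = 2^ρ`
and `Σ₁` or `Σ₂` is odd, then `𝓛(n)² = L²` for an integer `L` with `2^{ρ+1} ∤ L` (the contrapositive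
of the printed "`2^{−ρ(n)}𝓛(n)` is even only if `Σ₁ ≡ Σ₂ ≡ 0`", "even" meaning `2^{ρ+1} ∣ 𝓛(n)` by
Thm 3.5). At `ρ = 0` this is `exists_odd_scriptL_of_index_eq_one`.
[cite: TianYuanZhang2017, Thm. 1.2 (chunk p0002 L112–L120); Thm. 3.5 (chunk p0011 L94–L104)] -/
theorem exists_scriptL_not_dvd_of_index_eq_two_pow (h12 : thm12_parity_of_scriptL) {n : ℕ}
    (hsq : Squarefree n) (h8 : n % 8 = 5 ∨ n % 8 = 7) {ρ : ℕ} (hρ : (rhoSubgroup n).index = 2 ^ ρ)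
    (K : ℕ → Type) [∀ d, Field (K d)] [∀ d, NumberField (K d)] (hK : IsGenusFieldFamily n K)
    (hodd : Odd (genusSum₁ n fun d => genusClassNumber (K d)) ∨
      Odd (genusSum₂ n fun d => genusClassNumber (K d))) :
    ∃ L : ℤ, ¬ (2 : ℤ) ^ (ρ + 1) ∣ L ∧ IsScriptL n L := by
  obtain ⟨L, hL, h57, -⟩ := h12 n hsq (by omega) ρ hρ K hK
  refine ⟨L, fun h2 => ?_, hL⟩
  obtain ⟨e₁, e₂⟩ := h57 h8 h2
  rcases hodd with ho | ho
  · exact (Nat.not_even_iff_odd.mpr ho) e₁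
  · exact (Nat.not_even_iff_odd.mpr ho) e₂

/-- **TYZ Thm 1.2 at any `ρ(n)`, class `6`:** `Σ₂` odd forces `𝓛(n)² = L²` with `2^{ρ+1} ∤ L`.
[cite: TianYuanZhang2017, Thm. 1.2 (chunk p0002 L121–L127); Thm. 3.5 (chunk p0011 L94–L104)] -/
theorem exists_scriptL_not_dvd_of_index_eq_two_pow_six (h12 : thm12_parity_of_scriptL) {n : ℕ}
    (hsq : Squarefree n) (h8 : n % 8 = 6) {ρ : ℕ} (hρ : (rhoSubgroup n).index = 2 ^ ρ)
    (K : ℕ → Type) [∀ d, Field (K d)] [∀ d, NumberField (K d)] (hK : IsGenusFieldFamily n K)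
    (hodd : Odd (genusSum₂ n fun d => genusClassNumber (K d))) :
    ∃ L : ℤ, ¬ (2 : ℤ) ^ (ρ + 1) ∣ L ∧ IsScriptL n L := by
  obtain ⟨L, hL, -, h6⟩ := h12 n hsq (by omega) ρ hρ K hK
  exact ⟨L, fun h2 => (Nat.not_even_iff_odd.mpr hodd) (h6 h8 h2), hL⟩

/-- `2^{ρ+1} ∤ L` bounds the `2`-adic valuation: `L ≠ 0` and `ord₂ L ≤ ρ` (Mathlib
`padicValInt_dvd_iff`). [folklore] -/
private theorem ne_zero_and_padicValInt_le_of_not_dvd {L : ℤ} {ρ : ℕ}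
    (h : ¬ (2 : ℤ) ^ (ρ + 1) ∣ L) : L ≠ 0 ∧ padicValInt 2 L ≤ ρ := by
  have hL0 : L ≠ 0 := fun h0 => h (by rw [h0]; exact dvd_zero _)
  refine ⟨hL0, ?_⟩
  by_contra hlt
  refine h ((padicValInt_dvd_iff (p := 2) (ρ + 1) L).mpr (Or.inr ?_))
  omega

/-- **The rank-one datum at a general `ρ(n)`** (classes `5`, `7`): under the displayed fact
`thm12_parity_of_scriptL`, for square-free `n ≡ 5, 7 (mod 8)` with
`[E_n(ℚ) : φ_n(A_n(ℚ)) + E_n[2]] = 2^ρ` and `Σ₁` or `Σ₂` odd: `ord_{s=1} L(E_n, s) = 1` and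
`L′(E_n, 1) = 2^{2k(n)−2−a(n)} · L² · Ω(E_n) · Reg(E_n)` with `L ∈ ℤ`, `L ≠ 0`, `ord₂ L ≤ ρ`
(`2^{ρ+1} ∤ L`). At `ρ = 0`, `L` is odd (`rankOneDatum_of_index_eq_one`); at `ρ ≥ 1` the parity of
`L` is NOT decided by the printed theorem (lead ask L1-40: a `ρ = 1` consumer obtains rank-one
data, not the `2`-part). [cite: TianYuanZhang2017, Thm. 1.2, Thm. 3.5 and §1 (1.1)] -/
theorem rankOneDatum_of_index_eq_two_pow (h12 : thm12_parity_of_scriptL) {n : ℕ}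
    (hsq : Squarefree n) (h8 : n % 8 = 5 ∨ n % 8 = 7) {ρ : ℕ} (hρ : (rhoSubgroup n).index = 2 ^ ρ)
    (K : ℕ → Type) [∀ d, Field (K d)] [∀ d, NumberField (K d)] (hK : IsGenusFieldFamily n K)
    (hodd : Odd (genusSum₁ n fun d => genusClassNumber (K d)) ∨
      Odd (genusSum₂ n fun d => genusClassNumber (K d))) :
    ∃ L : ℤ, L ≠ 0 ∧ padicValInt 2 L ≤ ρ ∧ (congruentNumberCurve n).analyticRank = 1 ∧
      deriv (congruentNumberCurve n).entireLFunction 1 =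
        (2 : ℂ) ^ twoExponent n * (L : ℂ) ^ 2 *
          ((congruentNumberCurve n).realPeriodRat : ℂ) * ((congruentNumberCurve n).regulator : ℂ) := by
  obtain ⟨L, hLnd, hL⟩ := exists_scriptL_not_dvd_of_index_eq_two_pow h12 hsq h8 hρ K hK hodd
  obtain ⟨hL0, hval⟩ := ne_zero_and_padicValInt_le_of_not_dvd hLnd
  have hr := analyticRank_congruentNumberCurve_eq_one_of_isScriptL hsq (by omega) hL hL0
  refine ⟨L, hL0, hval, hr, ?_⟩
  rw [← (leadingLCoeff_eq_deriv_of_analyticRank_eq_one hr).1]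
  exact leadingLCoeff_congruentNumberCurve_eq_of_isScriptL (Nat.pos_of_ne_zero hsq.ne_zero) hr hL

/-- Class `6` companion of `rankOneDatum_of_index_eq_two_pow` (`Σ₂` odd).
[cite: TianYuanZhang2017, Thm. 1.2, Thm. 3.5 and §1 (1.1)] -/
theorem rankOneDatum_of_index_eq_two_pow_six (h12 : thm12_parity_of_scriptL) {n : ℕ}
    (hsq : Squarefree n) (h8 : n % 8 = 6) {ρ : ℕ} (hρ : (rhoSubgroup n).index = 2 ^ ρ)
    (K : ℕ → Type) [∀ d, Field (K d)] [∀ d, NumberField (K d)] (hK : IsGenusFieldFamily n K)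
    (hodd : Odd (genusSum₂ n fun d => genusClassNumber (K d))) :
    ∃ L : ℤ, L ≠ 0 ∧ padicValInt 2 L ≤ ρ ∧ (congruentNumberCurve n).analyticRank = 1 ∧
      deriv (congruentNumberCurve n).entireLFunction 1 =
        (2 : ℂ) ^ twoExponent n * (L : ℂ) ^ 2 *
          ((congruentNumberCurve n).realPeriodRat : ℂ) * ((congruentNumberCurve n).regulator : ℂ) := by
  obtain ⟨L, hLnd, hL⟩ := exists_scriptL_not_dvd_of_index_eq_two_pow_six h12 hsq h8 hρ K hK hodd
  obtain ⟨hL0, hval⟩ := ne_zero_and_padicValInt_le_of_not_dvd hLnd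
  have hr := analyticRank_congruentNumberCurve_eq_one_of_isScriptL hsq (by omega) hL hL0
  refine ⟨L, hL0, hval, hr, ?_⟩
  rw [← (leadingLCoeff_eq_deriv_of_analyticRank_eq_one hr).1]
  exact leadingLCoeff_congruentNumberCurve_eq_of_isScriptL (Nat.pos_of_ne_zero hsq.ne_zero) hr hL

/-! ### §6. ERRATUM F-Σ2 (2026-08-22): the same consequences from Thm 1.2 AS PRINTED (`thm12_parity_of_scriptL'`, `genusSum₂'`)

The GEN-1 fact `thm12_parity_of_scriptL` is MIS-STATED in its `Σ₂` clauses (its `genusSum₂` omits the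
`ℓ = 0` term; see the ERRATUM in `GenusPeriodsParity.lean`).  The primed twins below take the corrected
fact `thm12_parity_of_scriptL'` and the corrected sum `genusSum₂'`; for consumers feeding `Σ₁` (`Or.inl`)
nothing else changes.  The unprimed §3–§5 theorems are kept (referenced) but should no longer be consumed. -/

/-- **TYZ Thm 1.2 (AS PRINTED) with `ρ(n) = 0`, classes `5` and `7`:** `Σ₁` or `Σ₂'` odd forces `𝓛(n)`
odd. [cite: TianYuanZhang2017, Thm. 1.2 (chunk p0002 L112–L120); proof of Prop. 3.4 (p0016 L146)] -/
theorem exists_odd_scriptL_of_index_eq_one' (h12 : thm12_parity_of_scriptL') {n : ℕ}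
    (hsq : Squarefree n) (h8 : n % 8 = 5 ∨ n % 8 = 7) (hρ : (rhoSubgroup n).index = 1)
    (K : ℕ → Type) [∀ d, Field (K d)] [∀ d, NumberField (K d)] (hK : IsGenusFieldFamily n K)
    (hodd : Odd (genusSum₁ n fun d => genusClassNumber (K d)) ∨
      Odd (genusSum₂' n fun d => genusClassNumber (K d))) :
    ∃ L : ℤ, Odd L ∧ IsScriptL n L := by
  obtain ⟨L, hL, h57, -⟩ := h12 n hsq (by omega) 0 (by simpa using hρ) K hK
  refine ⟨L, ?_, hL⟩
  by_contra hne
  have h2 : (2 : ℤ) ^ (0 + 1) ∣ L := by simpa using (Int.not_odd_iff_even.mp hne).two_dvd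
  obtain ⟨e₁, e₂⟩ := h57 h8 h2
  rcases hodd with ho | ho
  · exact (Nat.not_even_iff_odd.mpr ho) e₁
  · exact (Nat.not_even_iff_odd.mpr ho) e₂

/-- **TYZ Thm 1.2 (AS PRINTED) with `ρ(n) = 0`, class `6`:** `Σ₂'` odd forces `𝓛(n)` odd.
[cite: TianYuanZhang2017, Thm. 1.2 (chunk p0002 L121–L127); proof of Prop. 3.4 (p0016 L146)] -/
theorem exists_odd_scriptL_of_index_eq_one_six' (h12 : thm12_parity_of_scriptL') {n : ℕ}
    (hsq : Squarefree n) (h8 : n % 8 = 6) (hρ : (rhoSubgroup n).index = 1)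
    (K : ℕ → Type) [∀ d, Field (K d)] [∀ d, NumberField (K d)] (hK : IsGenusFieldFamily n K)
    (hodd : Odd (genusSum₂' n fun d => genusClassNumber (K d))) :
    ∃ L : ℤ, Odd L ∧ IsScriptL n L := by
  obtain ⟨L, hL, -, h6⟩ := h12 n hsq (by omega) 0 (by simpa using hρ) K hK
  refine ⟨L, ?_, hL⟩
  by_contra hne
  have h2 : (2 : ℤ) ^ (0 + 1) ∣ L := by simpa using (Int.not_odd_iff_even.mp hne).two_dvd
  exact (Nat.not_even_iff_odd.mpr hodd) (h6 h8 h2)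

/-- **The rank-one datum from TYZ Thm 1.2 (AS PRINTED) at `ρ(n) = 0`** (classes `5`, `7`): square-free
`n ≡ 5, 7 (mod 8)`, `[E_n(ℚ) : φ_n(A_n(ℚ)) + E_n[2]] = 1`, `Σ₁` or `Σ₂'` odd ⟹ `ord_{s=1} L(E_n, s) = 1` and
`L′(E_n, 1) = 2^{2k(n)−2−a(n)} · L² · Ω(E_n) · Reg(E_n)` with `L` odd.
[cite: TianYuanZhang2017, Thm. 1.2 and §1 (1.1); proof of Prop. 3.4 (p0016 L146)] -/
theorem rankOneDatum_of_index_eq_one' (h12 : thm12_parity_of_scriptL') {n : ℕ}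
    (hsq : Squarefree n) (h8 : n % 8 = 5 ∨ n % 8 = 7) (hρ : (rhoSubgroup n).index = 1)
    (K : ℕ → Type) [∀ d, Field (K d)] [∀ d, NumberField (K d)] (hK : IsGenusFieldFamily n K)
    (hodd : Odd (genusSum₁ n fun d => genusClassNumber (K d)) ∨
      Odd (genusSum₂' n fun d => genusClassNumber (K d))) :
    ∃ L : ℤ, Odd L ∧ (congruentNumberCurve n).analyticRank = 1 ∧
      deriv (congruentNumberCurve n).entireLFunction 1 =
        (2 : ℂ) ^ twoExponent n * (L : ℂ) ^ 2 *
          ((congruentNumberCurve n).realPeriodRat : ℂ) * ((congruentNumberCurve n).regulator : ℂ) := by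
  obtain ⟨L, hLodd, hL⟩ := exists_odd_scriptL_of_index_eq_one' h12 hsq h8 hρ K hK hodd
  have hL0 : L ≠ 0 := fun h => by simp [h] at hLodd
  have hr := analyticRank_congruentNumberCurve_eq_one_of_isScriptL hsq (by omega) hL hL0
  refine ⟨L, hLodd, hr, ?_⟩
  rw [← (leadingLCoeff_eq_deriv_of_analyticRank_eq_one hr).1]
  exact leadingLCoeff_congruentNumberCurve_eq_of_isScriptL (Nat.pos_of_ne_zero hsq.ne_zero) hr hL

/-- Class `6` companion of `rankOneDatum_of_index_eq_one'` (`Σ₂'` odd).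
[cite: TianYuanZhang2017, Thm. 1.2 and §1 (1.1); proof of Prop. 3.4 (p0016 L146)] -/
theorem rankOneDatum_of_index_eq_one_six' (h12 : thm12_parity_of_scriptL') {n : ℕ}
    (hsq : Squarefree n) (h8 : n % 8 = 6) (hρ : (rhoSubgroup n).index = 1)
    (K : ℕ → Type) [∀ d, Field (K d)] [∀ d, NumberField (K d)] (hK : IsGenusFieldFamily n K)
    (hodd : Odd (genusSum₂' n fun d => genusClassNumber (K d))) :
    ∃ L : ℤ, Odd L ∧ (congruentNumberCurve n).analyticRank = 1 ∧
      deriv (congruentNumberCurve n).entireLFunction 1 =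
        (2 : ℂ) ^ twoExponent n * (L : ℂ) ^ 2 *
          ((congruentNumberCurve n).realPeriodRat : ℂ) * ((congruentNumberCurve n).regulator : ℂ) := by
  obtain ⟨L, hLodd, hL⟩ := exists_odd_scriptL_of_index_eq_one_six' h12 hsq h8 hρ K hK hodd
  have hL0 : L ≠ 0 := fun h => by simp [h] at hLodd
  have hr := analyticRank_congruentNumberCurve_eq_one_of_isScriptL hsq (by omega) hL hL0
  refine ⟨L, hLodd, hr, ?_⟩
  rw [← (leadingLCoeff_eq_deriv_of_analyticRank_eq_one hr).1]
  exact leadingLCoeff_congruentNumberCurve_eq_of_isScriptL (Nat.pos_of_ne_zero hsq.ne_zero) hr hL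

/-- **TYZ Thm 1.2 (AS PRINTED) at any `ρ(n)`, classes `5` and `7`:** `Σ₁` or `Σ₂'` odd ⟹ `𝓛(n)² = L²`
with `2^{ρ+1} ∤ L`. [cite: TianYuanZhang2017, Thm. 1.2 (chunk p0002 L112–L120); Thm. 3.5 (chunk p0011 L94–L104)] -/
theorem exists_scriptL_not_dvd_of_index_eq_two_pow' (h12 : thm12_parity_of_scriptL') {n : ℕ}
    (hsq : Squarefree n) (h8 : n % 8 = 5 ∨ n % 8 = 7) {ρ : ℕ} (hρ : (rhoSubgroup n).index = 2 ^ ρ)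
    (K : ℕ → Type) [∀ d, Field (K d)] [∀ d, NumberField (K d)] (hK : IsGenusFieldFamily n K)
    (hodd : Odd (genusSum₁ n fun d => genusClassNumber (K d)) ∨
      Odd (genusSum₂' n fun d => genusClassNumber (K d))) :
    ∃ L : ℤ, ¬ (2 : ℤ) ^ (ρ + 1) ∣ L ∧ IsScriptL n L := by
  obtain ⟨L, hL, h57, -⟩ := h12 n hsq (by omega) ρ hρ K hK
  refine ⟨L, fun h2 => ?_, hL⟩
  obtain ⟨e₁, e₂⟩ := h57 h8 h2
  rcases hodd with ho | ho
  · exact (Nat.not_even_iff_odd.mpr ho) e₁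
  · exact (Nat.not_even_iff_odd.mpr ho) e₂

/-- **TYZ Thm 1.2 (AS PRINTED) at any `ρ(n)`, class `6`:** `Σ₂'` odd ⟹ `2^{ρ+1} ∤ L`.
[cite: TianYuanZhang2017, Thm. 1.2 (chunk p0002 L121–L127); Thm. 3.5 (chunk p0011 L94–L104)] -/
theorem exists_scriptL_not_dvd_of_index_eq_two_pow_six' (h12 : thm12_parity_of_scriptL') {n : ℕ}
    (hsq : Squarefree n) (h8 : n % 8 = 6) {ρ : ℕ} (hρ : (rhoSubgroup n).index = 2 ^ ρ)
    (K : ℕ → Type) [∀ d, Field (K d)] [∀ d, NumberField (K d)] (hK : IsGenusFieldFamily n K)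
    (hodd : Odd (genusSum₂' n fun d => genusClassNumber (K d))) :
    ∃ L : ℤ, ¬ (2 : ℤ) ^ (ρ + 1) ∣ L ∧ IsScriptL n L := by
  obtain ⟨L, hL, -, h6⟩ := h12 n hsq (by omega) ρ hρ K hK
  exact ⟨L, fun h2 => (Nat.not_even_iff_odd.mpr hodd) (h6 h8 h2), hL⟩

/-- **The rank-one datum at a general `ρ(n)` from Thm 1.2 AS PRINTED** (classes `5`, `7`): `Σ₁` or `Σ₂'`
odd ⟹ `ord_{s=1} L(E_n, s) = 1`, `L′(E_n,1) = 2^{2k−2−a}·L²·Ω·Reg`, `L ≠ 0`, `ord₂ L ≤ ρ`.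
[cite: TianYuanZhang2017, Thm. 1.2, Thm. 3.5 and §1 (1.1)] -/
theorem rankOneDatum_of_index_eq_two_pow' (h12 : thm12_parity_of_scriptL') {n : ℕ}
    (hsq : Squarefree n) (h8 : n % 8 = 5 ∨ n % 8 = 7) {ρ : ℕ} (hρ : (rhoSubgroup n).index = 2 ^ ρ)
    (K : ℕ → Type) [∀ d, Field (K d)] [∀ d, NumberField (K d)] (hK : IsGenusFieldFamily n K)
    (hodd : Odd (genusSum₁ n fun d => genusClassNumber (K d)) ∨
      Odd (genusSum₂' n fun d => genusClassNumber (K d))) :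
    ∃ L : ℤ, L ≠ 0 ∧ padicValInt 2 L ≤ ρ ∧ (congruentNumberCurve n).analyticRank = 1 ∧
      deriv (congruentNumberCurve n).entireLFunction 1 =
        (2 : ℂ) ^ twoExponent n * (L : ℂ) ^ 2 *
          ((congruentNumberCurve n).realPeriodRat : ℂ) * ((congruentNumberCurve n).regulator : ℂ) := by
  obtain ⟨L, hLnd, hL⟩ := exists_scriptL_not_dvd_of_index_eq_two_pow' h12 hsq h8 hρ K hK hodd
  obtain ⟨hL0, hval⟩ := ne_zero_and_padicValInt_le_of_not_dvd hLnd
  have hr := analyticRank_congruentNumberCurve_eq_one_of_isScriptL hsq (by omega) hL hL0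
  refine ⟨L, hL0, hval, hr, ?_⟩
  rw [← (leadingLCoeff_eq_deriv_of_analyticRank_eq_one hr).1]
  exact leadingLCoeff_congruentNumberCurve_eq_of_isScriptL (Nat.pos_of_ne_zero hsq.ne_zero) hr hL

/-- Class `6` companion of `rankOneDatum_of_index_eq_two_pow'` (`Σ₂'` odd).
[cite: TianYuanZhang2017, Thm. 1.2, Thm. 3.5 and §1 (1.1)] -/
theorem rankOneDatum_of_index_eq_two_pow_six' (h12 : thm12_parity_of_scriptL') {n : ℕ}
    (hsq : Squarefree n) (h8 : n % 8 = 6) {ρ : ℕ} (hρ : (rhoSubgroup n).index = 2 ^ ρ)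
    (K : ℕ → Type) [∀ d, Field (K d)] [∀ d, NumberField (K d)] (hK : IsGenusFieldFamily n K)
    (hodd : Odd (genusSum₂' n fun d => genusClassNumber (K d))) :
    ∃ L : ℤ, L ≠ 0 ∧ padicValInt 2 L ≤ ρ ∧ (congruentNumberCurve n).analyticRank = 1 ∧
      deriv (congruentNumberCurve n).entireLFunction 1 =
        (2 : ℂ) ^ twoExponent n * (L : ℂ) ^ 2 *
          ((congruentNumberCurve n).realPeriodRat : ℂ) * ((congruentNumberCurve n).regulator : ℂ) := by
  obtain ⟨L, hLnd, hL⟩ := exists_scriptL_not_dvd_of_index_eq_two_pow_six' h12 hsq h8 hρ K hK hodd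
  obtain ⟨hL0, hval⟩ := ne_zero_and_padicValInt_le_of_not_dvd hLnd
  have hr := analyticRank_congruentNumberCurve_eq_one_of_isScriptL hsq (by omega) hL hL0
  refine ⟨L, hL0, hval, hr, ?_⟩
  rw [← (leadingLCoeff_eq_deriv_of_analyticRank_eq_one hr).1]
  exact leadingLCoeff_congruentNumberCurve_eq_of_isScriptL (Nat.pos_of_ne_zero hsq.ne_zero) hr hL

/-- **`Σ₁` with no non-trivial factor `≡ 1 (mod 8)`**: if no divisor `d` of `n` with `1 < d < n` is
`≡ 1 (mod 8)`, only the trivial decomposition `{n}` contributes to the first genus sum, `Σ₁(n; g) = g(n)`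
(`n > 1`).  E.g. `n = pq` with primes `p, q ≢ 1 (mod 8)`: `Σ₁(pq) = g(pq)`.
[cite: TianYuanZhang2017, Thm. 1.2 (Σ₁: "n = d₀d₁⋯d_ℓ, dᵢ ≡ 1 (mod 8), i > 0", all dᵢ > 1)] -/
theorem genusSum₁_eq_self {n : ℕ} (hn : 1 < n) (h : ∀ d, d ∣ n → 1 < d → d < n → d % 8 ≠ 1)
    (g : ℕ → ℕ) : genusSum₁ n g = g n := by
  unfold genusSum₁
  have hF : (decompositions n).filter (fun D => (D.filter fun d => d % 8 ≠ 1).card ≤ 1) = {{n}} := by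
    ext D
    simp only [Finset.mem_filter, Finset.mem_singleton]
    constructor
    · rintro ⟨hD, hcard⟩
      by_contra hDn
      have hD' := hD
      simp only [decompositions, Finset.mem_filter, Finset.mem_powerset] at hD'
      obtain ⟨hsub, hgt, -, hprod⟩ := hD'
      have hne : D.Nonempty := by
        rw [Finset.nonempty_iff_ne_empty]
        rintro rfl
        rw [Finset.prod_empty] at hprod
        omega
      obtain ⟨d₁, hd₁⟩ := hne
      obtain ⟨d₂, hd₂, hne⟩ : ∃ d₂ ∈ D, d₂ ≠ d₁ := by
        by_contra hall
        push Not at hall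
        exact hDn (eq_singleton_of_mem_decompositions hD hd₁ hall)
      -- every factor accompanied by another factor `> 1` is a proper divisor
      have hlt : ∀ d ∈ D, ∀ d' ∈ D, d' ≠ d → d < n := by
        intro d hd d' hd' hne'
        have hmul : d * ∏ e ∈ D.erase d, e = n := by
          rw [← hprod]; exact Finset.mul_prod_erase D (fun e => e) hd
        have hge : d' ≤ ∏ e ∈ D.erase d, e :=
          Finset.single_le_prod' (f := fun e => e) (fun e he => (hgt e (Finset.mem_of_mem_erase he)).le)
            (Finset.mem_erase.mpr ⟨hne', hd'⟩)
        have h1 : 1 < ∏ e ∈ D.erase d, e := (hgt d' hd').trans_le hge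
        have hd0 : 0 < d := by linarith [hgt d hd]
        nlinarith
      have hmem : ∀ d ∈ D, (∃ d' ∈ D, d' ≠ d) → d ∈ D.filter fun d => d % 8 ≠ 1 := by
        rintro d hd ⟨d', hd', hne'⟩
        exact Finset.mem_filter.mpr
          ⟨hd, h d (Nat.dvd_of_mem_divisors (hsub hd)) (hgt d hd) (hlt d hd d' hd' hne')⟩
      have h2 : 1 < (D.filter fun d => d % 8 ≠ 1).card :=
        Finset.one_lt_card.mpr ⟨d₁, hmem d₁ hd₁ ⟨d₂, hd₂, hne⟩, d₂, hmem d₂ hd₂ ⟨d₁, hd₁, hne.symm⟩, hne.symm⟩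
      omega
    · rintro rfl
      exact ⟨singleton_mem_decompositions hn,
        (Finset.card_filter_le _ _).trans (Finset.card_singleton n).le⟩
  rw [hF, Finset.sum_singleton, Finset.prod_singleton]

/-- **The `Σ₁ / Σ₂'` split** (re-key helper for doors that fed the GEN-1 `Σ₂`): for `1 < n ≡ 5, 6, 7 (mod 8)`,
if the GEN-1 sum `Σ₂(n; g)` is odd and `Σ₁(n; g) ≡ g(n) (mod 2)`, then `Σ₁` or the printed
`Σ₂' = Σ₂ + g(n)` is odd — according as `g(n)` is odd or even.  E.g. `n = pq`, `p ≡ 3`, `q ≡ 5 (mod 8)`: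
`Σ₁ = g(pq)` (`genusSum₁_eq_self`), `Σ₂ = g(p)g(q)`, `Σ₂' = g(pq) + g(p)g(q)`.
[cite: TianYuanZhang2017, Thm. 1.2 (Σ₁, Σ₂ as printed)] -/
theorem odd_genusSum₁_or_odd_genusSum₂' {n : ℕ} (hn : 1 < n) (h8 : n % 8 = 5 ∨ n % 8 = 6 ∨ n % 8 = 7)
    (g : ℕ → ℕ) (h₂ : Odd (genusSum₂ n g)) (h₁ : Odd (genusSum₁ n g) ↔ Odd (g n)) :
    Odd (genusSum₁ n g) ∨ Odd (genusSum₂' n g) := by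
  rcases Nat.even_or_odd (g n) with he | ho
  · exact Or.inr ((odd_genusSum₂'_iff hn h8 g).mpr (iff_of_true h₂ he))
  · exact Or.inl (h₁.mpr ho)

/-- **Parity transfer for the printed `Σ₂` over concrete fields**: with `g(d) mod 2` supplied as a `0/1`
function agreeing with `genusClassNumber (K d)` on the divisors `d > 1`, `Σ₂'` transfers like `Σ₁`, `Σ₂`.
(For the sub-lane's decidable form: `Σ₂'` is odd iff exactly one of `Σ₂` and `g(n)` is,
`odd_genusSum₂'_iff`.) [cite: TianYuanZhang2017, Thm. 1.2 (Σ₂)] -/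
theorem odd_genusSum₂'_iff_of_mod_two_eq' (n : ℕ) {g g' : ℕ → ℕ}
    (h : ∀ d ∈ n.divisors, 1 < d → g d % 2 = g' d % 2) :
    Odd (genusSum₂' n g) ↔ Odd (genusSum₂' n g') :=
  odd_genusSum₂'_iff_of_mod_two_eq n h

end Literature.NumberTheory.EllipticCurves.TianYuanZhang2017

end
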